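import Summits.SmoothPoincare4.SmoothPoincare4.Theorems.CongruenceShadowsAgkCor6SufficiencyStubTransportPair
import Summits.SmoothPoincare4.SmoothPoincare4.Theorems.CongruenceShadowsAgkCor6SufficiencyStubThetaData
import Literature.Topology.FourManifolds.TrisectionFunctor

/-!
# Stub `stub_transport` of line `lp-by-sphere-system-surgery` for crux `AgkCor6Sufficiency`, part 4 (main):
# gluing the tube map and the slab maps — the transport of open spine neighbourhoods
(item stmt-SmoothPoincare4-10894, routes CongruenceShadows / GroupTrisection; lead reshape r5, C)

**Transport of open spine neighbourhoods** (Abrams–Gay–Kirby, proof of Thm. 5: "the spine determines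
a neighbourhood", here on OPEN sets and level-preserving).  With the two-sided data `D : TransportHyp`
(parts 1–3) and an admissible slab thickness `ε₂`, put
`Γ := tubeMap` on the tube `T(4 r₀)` and `Γ := slabMap m` on the seam slab of seam `m`
(`TransportHyp.glue`), on the open set `Ug := T(4 r₀) ∪ ⋃ₘ seamSlab m ε₂` (`TransportHyp.dom`).  The
two prescriptions agree on overlaps (`slabMap_eq_tubeMap_of_mem_tube4`), the slabs are pairwise
disjoint (`SeamForms.N_disjoint`), so `Γ` is smooth; it maps `Ug` into the corresponding set of `X'`,
is inverted by the same construction for `D.symm`, carries sectors to sectors and intertwines the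
normalised presentations; and `Ug` contains the spine (a non-interior point of a sector lies in a
seam — `not_mem_interior_iff_exists_mem` — hence in the tube or in a slab).  This file declares the
line's statement `TransportStmt` (verbatim from the checked skeleton, reshape r5b with `SeamFlow9`)
and proves the registered stub `stub_transport`.

References: Abrams–Gay–Kirby, Geom. Topol. 22 (2018), proof of Thm. 5 [AbramsGayKirby2018];
Gay–Kirby, Geom. Topol. 20 (2016), Def. 1 [GayKirby2016]; Milnor, *Lectures on the h-cobordism
theorem* (1965), proof of Thm. 3.4 [MilnorHCobordism1965].
-/

noncomputable section

set_option linter.dupNamespace false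

namespace Summit.SmoothPoincare4.SmoothPoincare4.Cruxes.AgkCor6Sufficiency.LpBySphereSystemSurgery

open Set Function
open scoped _root_.Manifold _root_.ContDiff _root_.Topology
open Literature.Topology.FourManifolds

/-! ## The statement (verbatim from the skeleton) -/

/-- **C — transport of open spine neighbourhoods** (the lead's stub): the tube map
`x ↦ tp' (Ψa (ρ x)) (u x) (v x)` on `T(4 r₀)` and, on thin slabs around the seam pieces
`H_m ∖ T(2 r₀)`, the flow conjugations `x ↦ φ'_m (hd' (Φ_m (hd⁻¹ (φ_m x (-σ_m x))))) (σ_m x)`;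
they agree on the overlap (canonical zone: explicit flows, product-like `Φ_m`), are mutually
inverse with the symmetric formulas, carry sectors to sectors and intertwine the presentations
(unit forms in the tube, band forms `bandForm r₀ p σ` in the canonical zone, seam forms beyond). -/
def TransportStmt : Prop :=
  ∀ (X : Type) [TopologicalSpace X] [T2Space X] [SecondCountableTopology X]
    [ChartedSpace (EuclideanSpace ℝ (Fin 4)) X] [IsManifold (𝓡 4) ∞ X] [CompactSpace X]
    (X' : Type) [TopologicalSpace X'] [T2Space X'] [SecondCountableTopology X']
    [ChartedSpace (EuclideanSpace ℝ (Fin 4)) X'] [IsManifold (𝓡 4) ∞ X'] [CompactSpace X']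
    (k : ℕ) (S : Fin 3 → Set X) (S' : Fin 3 → Set X')
    (ψ : centralSurface S ≃ₜ centralSurface S')
    (u v : X → ℝ) (ρ : X → X) (U O T₀ Ot : Set X) (rt : ℝ) (tp : X → ℝ → ℝ → X)
    (G : Fin 3 → X → ℝ) (ε₁ : ℝ) (N Nf : Fin 3 → Set X) (δ : Fin 3 → ℝ) (φ : Fin 3 → X → ℝ → X)
    (u' v' : X' → ℝ) (ρ' : X' → X') (U' O' T₀' Ot' : Set X') (rt' : ℝ) (tp' : X' → ℝ → ℝ → X')
    (G' : Fin 3 → X' → ℝ) (ε₁' : ℝ) (N' Nf' : Fin 3 → Set X') (δ' : Fin 3 → ℝ)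
    (φ' : Fin 3 → X' → ℝ → X')
    (Uψ : Set X) (Ψa : X → X') (Uψ' : Set X') (Ψa' : X' → X) (r₀ rP : ℝ),
    SpinePresentation S u v ρ U O T₀ G k → TubeStructure (S 0) (⋂ l, S l) u v ρ O Ot rt tp →
    SeamForms S u v Ot G r₀ ε₁ N → (∀ m, SeamFlow9 S u v ρ Ot tp G r₀ N m (Nf m) (δ m) (φ m)) →
    SpinePresentation S' u' v' ρ' U' O' T₀' G' k →
    TubeStructure (S' 0) (⋂ l, S' l) u' v' ρ' O' Ot' rt' tp' →
    SeamForms S' u' v' Ot' G' r₀ ε₁' N' →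
    (∀ m, SeamFlow9 S' u' v' ρ' Ot' tp' G' r₀ N' m (Nf' m) (δ' m) (φ' m)) →
    SeamDiffeos S S' u v ρ Ot tp u' v' ρ' Ot' tp' Ψa Ψa' rP →
    20 * r₀ ≤ rP → 20 * r₀ ≤ rt → 20 * r₀ ≤ rt' →
    tubeSet Ot u v (4 * r₀) ⊆ T₀ → tubeSet Ot' u' v' (4 * r₀) ⊆ T₀' →
    IsOpen Uψ → (⋂ l, S l) ⊆ Uψ → ContMDiffOn (𝓡 4) (𝓡 4) ∞ Ψa Uψ →
    (∀ x : centralSurface S, Ψa x = (ψ x : X')) →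
    IsOpen Uψ' → (⋂ l, S' l) ⊆ Uψ' → ContMDiffOn (𝓡 4) (𝓡 4) ∞ Ψa' Uψ' →
    (∀ x : centralSurface S', Ψa' x = (ψ.symm x : X)) →
    SpineTransport S S' G G'

/-! ## Two distinct sectors meet in a seam -/

/-- Two distinct sectors meet in a seam. -/
theorem exists_seam_of_ne {Y : Type} {m₁ j : Fin 3} (h : m₁ ≠ j) :
    ∃ m : Fin 3, ∀ T : Fin 3 → Set Y, T m₁ ∩ T j ⊆ T (m + 1) ∩ T (m + 2) := by
  fin_cases m₁ <;> fin_cases j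
  all_goals first
    | exact absurd rfl h
    | exact ⟨2, fun T => fun x hx => ⟨hx.1, hx.2⟩⟩
    | exact ⟨2, fun T => fun x hx => ⟨hx.2, hx.1⟩⟩
    | exact ⟨1, fun T => fun x hx => ⟨hx.2, hx.1⟩⟩
    | exact ⟨1, fun T => fun x hx => ⟨hx.1, hx.2⟩⟩
    | exact ⟨0, fun T => fun x hx => ⟨hx.1, hx.2⟩⟩
    | exact ⟨0, fun T => fun x hx => ⟨hx.2, hx.1⟩⟩

/-! ## Gluing -/

section Glue

variable {X : Type} [TopologicalSpace X] [ChartedSpace (EuclideanSpace ℝ (Fin 4)) X]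
  {X' : Type} [TopologicalSpace X'] [ChartedSpace (EuclideanSpace ℝ (Fin 4)) X']
  {S : Fin 3 → Set X} {S' : Fin 3 → Set X'}
  {u v : X → ℝ} {ρ : X → X} {U O T₀ Ot : Set X} {rt : ℝ} {tp : X → ℝ → ℝ → X}
  {G : Fin 3 → X → ℝ} {ε₁ : ℝ} {N Nf : Fin 3 → Set X} {δ : Fin 3 → ℝ} {φ : Fin 3 → X → ℝ → X}
  {W : Fin 3 → Set X} {Ψs : Fin 3 → X → X'} {Uψ : Set X} {Ψa : X → X'}
  {u' v' : X' → ℝ} {ρ' : X' → X'} {U' O' T₀' Ot' : Set X'} {rt' : ℝ} {tp' : X' → ℝ → ℝ → X'}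
  {G' : Fin 3 → X' → ℝ} {ε₁' : ℝ} {N' Nf' : Fin 3 → Set X'} {δ' : Fin 3 → ℝ}
  {φ' : Fin 3 → X' → ℝ → X'} {W' : Fin 3 → Set X'} {Ψs' : Fin 3 → X' → X} {Uψ' : Set X'}
  {Ψa' : X' → X} {k : ℕ} {r₀ rP : ℝ}

namespace TransportHyp

open Classical in
/-- **The glued map**: the tube map on `T(4 r₀)`, the slab map of seam `m` on the seam slab of `m`. -/
def glue (D : TransportHyp S S' u v ρ U O T₀ Ot rt tp G ε₁ N Nf δ φ W Ψs Uψ Ψa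
    u' v' ρ' U' O' T₀' Ot' rt' tp' G' ε₁' N' Nf' δ' φ' W' Ψs' Uψ' Ψa' k r₀ rP) (ε₂ : ℝ) (x : X) : X' :=
  if x ∈ tubeSet Ot u v (4 * r₀) then tubeMap tp' Ψa ρ u v x
  else if x ∈ seamSlab Ot u v G r₀ 0 (Nf 0) (φ 0) ε₂ then D.slabMap 0 x
  else if x ∈ seamSlab Ot u v G r₀ 1 (Nf 1) (φ 1) ε₂ then D.slabMap 1 x
  else if x ∈ seamSlab Ot u v G r₀ 2 (Nf 2) (φ 2) ε₂ then D.slabMap 2 x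
  else tubeMap tp' Ψa ρ u v x

/-- **The domain**: the tube `T(4 r₀)` and the three seam slabs. -/
def dom (_D : TransportHyp S S' u v ρ U O T₀ Ot rt tp G ε₁ N Nf δ φ W Ψs Uψ Ψa
    u' v' ρ' U' O' T₀' Ot' rt' tp' G' ε₁' N' Nf' δ' φ' W' Ψs' Uψ' Ψa' k r₀ rP) (ε₂ : ℝ) : Set X :=
  tubeSet Ot u v (4 * r₀) ∪ ⋃ m, seamSlab Ot u v G r₀ m (Nf m) (φ m) ε₂

variable (D : TransportHyp S S' u v ρ U O T₀ Ot rt tp G ε₁ N Nf δ φ W Ψs Uψ Ψa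
    u' v' ρ' U' O' T₀' Ot' rt' tp' G' ε₁' N' Nf' δ' φ' W' Ψs' Uψ' Ψa' k r₀ rP)
include D

/-- **Admissible slab thicknesses exist.** -/
theorem exists_slabWidth : ∃ ε₂, D.SlabWidth ε₂ := by
  set a : ℝ := min (min (min (min (δ 0) (min (δ 1) (δ 2))) (min (δ' 0) (min (δ' 1) (δ' 2)))) ε₁) ε₁'
    with ha
  have hδ := fun m => (D.flow m).δ_pos
  have hδ' := fun m => (D.flow' m).δ_pos
  have ha0 : 0 < a := by
    simp only [ha, lt_min_iff]
    exact ⟨⟨⟨⟨hδ 0, hδ 1, hδ 2⟩, hδ' 0, hδ' 1, hδ' 2⟩, D.forms.ε₁_pos⟩, D.forms'.ε₁_pos⟩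
  have haδ : ∀ m, a ≤ δ m := by
    intro m
    rcases D.pres.tri.eq_or m with rfl | rfl | rfl <;> simp only [ha] <;>
      [exact (((min_le_left _ _).trans (min_le_left _ _)).trans (min_le_left _ _)).trans (min_le_left _ _);
       exact ((((min_le_left _ _).trans (min_le_left _ _)).trans (min_le_left _ _)).trans
         (min_le_right _ _)).trans (min_le_left _ _);
       exact ((((min_le_left _ _).trans (min_le_left _ _)).trans (min_le_left _ _)).trans
         (min_le_right _ _)).trans (min_le_right _ _)]
  have haδ' : ∀ m, a ≤ δ' m := by
    intro m
    rcases D.pres.tri.eq_or m with rfl | rfl | rfl <;> simp only [ha] <;>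
      [exact (((min_le_left _ _).trans (min_le_left _ _)).trans (min_le_right _ _)).trans (min_le_left _ _);
       exact ((((min_le_left _ _).trans (min_le_left _ _)).trans (min_le_right _ _)).trans
         (min_le_right _ _)).trans (min_le_left _ _);
       exact ((((min_le_left _ _).trans (min_le_left _ _)).trans (min_le_right _ _)).trans
         (min_le_right _ _)).trans (min_le_right _ _)]
  refine ⟨a / 2, by positivity, fun m => ?_, fun m => ?_, ?_, ?_⟩
  · linarith [haδ m]
  · linarith [haδ' m]
  · linarith [show a ≤ ε₁ from (min_le_left _ _).trans (min_le_right _ _)]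
  · linarith [show a ≤ ε₁' from min_le_right _ _]

/-- The seam slabs are pairwise disjoint (they lie in the disjoint `N m`). -/
theorem eq_of_mem_seamSlab {ε₂ : ℝ} {m m' : Fin 3} {x : X}
    (h : x ∈ seamSlab Ot u v G r₀ m (Nf m) (φ m) ε₂)
    (h' : x ∈ seamSlab Ot u v G r₀ m' (Nf m') (φ m') ε₂) : m = m' := by
  by_contra hne
  exact Set.disjoint_left.1 (D.forms.N_disjoint m m' hne) ((D.flow m).Nf_subset h.1)
    ((D.flow m').Nf_subset h'.1)

/-- On the tube the glued map is the tube map. -/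
theorem glue_eq_tubeMap {ε₂ : ℝ} {x : X} (hx : x ∈ tubeSet Ot u v (4 * r₀)) :
    D.glue ε₂ x = tubeMap tp' Ψa ρ u v x := by
  simp only [glue, hx, if_true]

/-- **On the seam slab of `m` the glued map is the slab map of `m`** (agreement on the tube,
disjointness of the slabs). -/
theorem glue_eq_slabMap {ε₂ : ℝ} (hε : D.SlabWidth ε₂) {m : Fin 3} {x : X}
    (hx : x ∈ seamSlab Ot u v G r₀ m (Nf m) (φ m) ε₂) : D.glue ε₂ x = D.slabMap m x := by
  by_cases h4 : x ∈ tubeSet Ot u v (4 * r₀)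
  · rw [D.glue_eq_tubeMap h4, D.slabMap_eq_tubeMap_of_mem_tube4 hε hx h4]
  have key : ∀ m' : Fin 3, x ∈ seamSlab Ot u v G r₀ m' (Nf m') (φ m') ε₂ ↔ m' = m := fun m' =>
    ⟨fun h => D.eq_of_mem_seamSlab h hx, fun h => h ▸ hx⟩
  rcases D.pres.tri.eq_or m with rfl | rfl | rfl
  · simp only [glue, h4, if_false, hx, if_true]
  · have h0 : x ∉ seamSlab Ot u v G r₀ 0 (Nf 0) (φ 0) ε₂ := fun h => by
      have := (key 0).1 h; exact absurd this (by decide)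
    simp only [glue, h4, if_false, h0, hx, if_true]
  · have h0 : x ∉ seamSlab Ot u v G r₀ 0 (Nf 0) (φ 0) ε₂ := fun h => by
      have := (key 0).1 h; exact absurd this (by decide)
    have h1 : x ∉ seamSlab Ot u v G r₀ 1 (Nf 1) (φ 1) ε₂ := fun h => by
      have := (key 1).1 h; exact absurd this (by decide)
    simp only [glue, h4, if_false, h0, h1, hx, if_true]

/-- **The domain is open.** -/
theorem isOpen_dom [T2Space X] [IsManifold (𝓡 4) ∞ X] {ε₂ : ℝ} (hε : D.SlabWidth ε₂) :
    IsOpen (D.dom ε₂) :=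
  (isOpen_tubeSet D.tube D.pres.tri.frame _).union (isOpen_iUnion fun m =>
    isOpen_seamSlab D.pres D.tube D.forms (D.flow m) D.rt_le (hε.2.1 m))

/-- **The domain contains the spine**: every non-interior point of a sector. -/
theorem spine_sub_dom [T2Space X] {ε₂ : ℝ} (hε : D.SlabWidth ε₂) (m₁ : Fin 3) {x : X} (hx : x ∈ S m₁)
    (hint : x ∉ interior (S m₁)) : x ∈ D.dom ε₂ := by
  obtain ⟨j, hj, hxj⟩ := (not_mem_interior_iff_exists_mem D.pres.tri m₁ x).1 hint
  obtain ⟨m, hm⟩ := exists_seam_of_ne (Y := X) (Ne.symm hj)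
  have hseam : x ∈ S (m + 1) ∩ S (m + 2) := hm S ⟨hx, hxj⟩
  by_cases h4 : x ∈ tubeSet Ot u v (4 * r₀)
  · exact Or.inl h4
  · exact Or.inr (mem_iUnion.2 ⟨m, mem_seamSlab_of_mem_seam D.forms (D.flow m) hε.1 hseam h4⟩)

/-- **The glued map is smooth on the domain.** -/
theorem contMDiffOn_glue [T2Space X] [IsManifold (𝓡 4) ∞ X] [IsManifold (𝓡 4) ∞ X'] {ε₂ : ℝ}
    (hε : D.SlabWidth ε₂) : ContMDiffOn (𝓡 4) (𝓡 4) ∞ (D.glue ε₂) (D.dom ε₂) := by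
  have hr₀ := D.r₀_pos
  have hs4 : (4 * r₀) ^ 2 ≤ rt' ^ 2 := by nlinarith [D.rt'_le]
  apply contMDiffOn_of_locally_contMDiffOn
  rintro x (h4 | hsl)
  · refine ⟨tubeSet Ot u v (4 * r₀), isOpen_tubeSet D.tube D.pres.tri.frame _, h4, ?_⟩
    refine ((contMDiffOn_tubeMap D.tube D.pres.tri.frame D.tube' D.pres'.tri.frame D.ΨaF
      D.isOpen_Uψ D.F_sub_Uψ D.smooth_Ψa hs4).mono inter_subset_right).congr fun y hy => ?_
    exact D.glue_eq_tubeMap hy.2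
  · obtain ⟨m, hm⟩ := mem_iUnion.1 hsl
    refine ⟨seamSlab Ot u v G r₀ m (Nf m) (φ m) ε₂,
      isOpen_seamSlab D.pres D.tube D.forms (D.flow m) D.rt_le (hε.2.1 m), hm, ?_⟩
    refine ((D.contMDiffOn_slabMap hε m).mono inter_subset_right).congr fun y hy => ?_
    exact D.glue_eq_slabMap hε hy.2

/-- **The glued map carries the domain into the domain of the symmetric data.** -/
theorem mapsTo_glue {ε₂ : ℝ} (hε : D.SlabWidth ε₂) : MapsTo (D.glue ε₂) (D.dom ε₂) (D.symm.dom ε₂) := by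
  have hr₀ := D.r₀_pos
  have hs4 : (4 * r₀) ^ 2 ≤ rt' ^ 2 := by nlinarith [D.rt'_le]
  rintro x (h4 | hsl)
  · rw [D.glue_eq_tubeMap h4]
    exact Or.inl (tubeMap_mem_tubeSet D.tube D.pres.tri.frame D.tube' D.ΨaF hs4 h4)
  · obtain ⟨m, hm⟩ := mem_iUnion.1 hsl
    rw [D.glue_eq_slabMap hε hm]
    exact Or.inr (mem_iUnion.2 ⟨m, (D.slabMap_spec hε hm).1⟩)

/-- **The glued map of the symmetric data inverts the glued map.** -/
theorem glue_symm_glue {ε₂ : ℝ} (hε : D.SlabWidth ε₂) {x : X} (hx : x ∈ D.dom ε₂) :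
    D.symm.glue ε₂ (D.glue ε₂ x) = x := by
  have hr₀ := D.r₀_pos
  have hs4 : (4 * r₀) ^ 2 ≤ rt' ^ 2 := by nlinarith [D.rt'_le]
  rcases hx with h4 | hsl
  · rw [D.glue_eq_tubeMap h4,
      D.symm.glue_eq_tubeMap (tubeMap_mem_tubeSet D.tube D.pres.tri.frame D.tube' D.ΨaF hs4 h4)]
    exact tubeMap_tubeMap D.tube D.pres.tri.frame D.tube' D.ΨaF D.inv_Ψa hs4 h4
  · obtain ⟨m, hm⟩ := mem_iUnion.1 hsl
    rw [D.glue_eq_slabMap hε hm, D.symm.glue_eq_slabMap hε.symm (D.slabMap_spec hε hm).1]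
    exact D.slabMap_symm_slabMap hε hm

/-- **The glued map carries sectors to sectors.** -/
theorem glue_mem_sector {ε₂ : ℝ} (hε : D.SlabWidth ε₂) {x : X} (hx : x ∈ D.dom ε₂) {m₁ : Fin 3}
    (hxm : x ∈ S m₁) : D.glue ε₂ x ∈ S' m₁ := by
  have hr₀ := D.r₀_pos
  have hs4 : (4 * r₀) ^ 2 ≤ rt' ^ 2 := by nlinarith [D.rt'_le]
  rcases hx with h4 | hsl
  · rw [D.glue_eq_tubeMap h4]
    exact tubeMap_mem_sector D.tube D.pres.tri D.tube' D.pres'.tri D.ΨaF hs4 h4 hxm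
  · obtain ⟨m, hm⟩ := mem_iUnion.1 hsl
    rw [D.glue_eq_slabMap hε hm]
    exact D.slabMap_mem_sector hε hm hxm

/-- **The glued map intertwines the normalised presentations.** -/
theorem glue_level {ε₂ : ℝ} (hε : D.SlabWidth ε₂) {x : X} (hx : x ∈ D.dom ε₂) {m₁ : Fin 3}
    (hxm : x ∈ S m₁) : G' m₁ (D.glue ε₂ x) = G m₁ x := by
  have hr₀ := D.r₀_pos
  have hs4 : (4 * r₀) ^ 2 ≤ rt' ^ 2 := by nlinarith [D.rt'_le]
  rcases hx with h4 | hsl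
  · rw [D.glue_eq_tubeMap h4]
    exact tubeMap_level D.tube D.pres.tri.frame D.tube' D.ΨaF hs4 D.pres.unit D.pres'.unit
      D.T₀_sub D.T₀'_sub h4 m₁
  · obtain ⟨m, hm⟩ := mem_iUnion.1 hsl
    rw [D.glue_eq_slabMap hε hm]
    exact D.slabMap_level hε hm hxm

end TransportHyp

end Glue

/-! ## The registered stub -/

/-- **Registered stub `stub_transport` — transport of open spine neighbourhoods** (AGK Thm. 5,
"the spine determines a neighbourhood", in level-preserving form on open sets).
[cite: AbramsGayKirby2018, proof of Thm. 5] -/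
theorem stub_transport : TransportStmt := by
  intro X _ _ _ _ _ _ X' _ _ _ _ _ _ k S S' ψ u v ρ U O T₀ Ot rt tp G ε₁ N Nf δ φ u' v' ρ' U' O' T₀'
    Ot' rt' tp' G' ε₁' N' Nf' δ' φ' Uψ Ψa Uψ' Ψa' r₀ rP hP hTS hSF hfl hP' hTS' hSF' hfl' hSD h20rP
    h20 h20' hT₀ hT₀' hUψo hFUψ hΨas hΨaψ hUψo' hFUψ' hΨas' hΨaψ'
  choose W Ψs W' Ψs' hW using hSD.2
  have hΨaF : ∀ x ∈ ⋂ l, S l, Ψa x ∈ ⋂ l, S' l := fun x hx => by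
    rw [hΨaψ ⟨x, hx⟩]; exact (ψ ⟨x, hx⟩).2
  have hΨa'F : ∀ x' ∈ ⋂ l, S' l, Ψa' x' ∈ ⋂ l, S l := fun x hx => by
    rw [hΨaψ' ⟨x, hx⟩]; exact (ψ.symm ⟨x, hx⟩).2
  have hinv : ∀ x ∈ ⋂ l, S l, Ψa' (Ψa x) = x := fun x hx => by
    rw [hΨaψ ⟨x, hx⟩, hΨaψ' (ψ ⟨x, hx⟩), Homeomorph.symm_apply_apply]
  have hinv' : ∀ x' ∈ ⋂ l, S' l, Ψa (Ψa' x') = x' := fun x hx => by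
    rw [hΨaψ' ⟨x, hx⟩, hΨaψ (ψ.symm ⟨x, hx⟩), Homeomorph.apply_symm_apply]
  have D : TransportHyp S S' u v ρ U O T₀ Ot rt tp G ε₁ N Nf δ φ W Ψs Uψ Ψa
      u' v' ρ' U' O' T₀' Ot' rt' tp' G' ε₁' N' Nf' δ' φ' W' Ψs' Uψ' Ψa' k r₀ rP :=
    { pres := hP, tube := hTS, forms := hSF, flow := hfl, pres' := hP', tube' := hTS',
      forms' := hSF', flow' := hfl', rP_pos := hSD.1, rP_le := h20rP, rt_le := h20, rt'_le := h20',
      T₀_sub := hT₀, T₀'_sub := hT₀',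
      isOpen_W := fun m => (hW m).1, seam_sub_W := fun m => (hW m).2.1,
      smooth_Ψs := fun m => (hW m).2.2.1, isOpen_W' := fun m => (hW m).2.2.2.1,
      seam_sub_W' := fun m => (hW m).2.2.2.2.1, smooth_Ψs' := fun m => (hW m).2.2.2.2.2.1,
      mapsTo_Ψs := fun m => (hW m).2.2.2.2.2.2.1, mapsTo_Ψs' := fun m => (hW m).2.2.2.2.2.2.2.1,
      inv_Ψs := fun m => (hW m).2.2.2.2.2.2.2.2.1, inv_Ψs' := fun m => (hW m).2.2.2.2.2.2.2.2.2.1,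
      prod_Ψs := fun m => (hW m).2.2.2.2.2.2.2.2.2.2.1,
      prod_Ψs' := fun m => (hW m).2.2.2.2.2.2.2.2.2.2.2,
      isOpen_Uψ := hUψo, F_sub_Uψ := hFUψ, smooth_Ψa := hΨas, ΨaF := hΨaF,
      isOpen_Uψ' := hUψo', F_sub_Uψ' := hFUψ', smooth_Ψa' := hΨas', Ψa'F := hΨa'F,
      inv_Ψa := hinv, inv_Ψa' := hinv' }
  obtain ⟨ε₂, hε⟩ := D.exists_slabWidth
  refine ⟨D.dom ε₂, D.symm.dom ε₂, D.glue ε₂, D.symm.glue ε₂, D.isOpen_dom hε, D.symm.isOpen_dom hε.symm,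
    fun m x hx hint => D.spine_sub_dom hε m hx hint,
    fun m x hx hint => D.symm.spine_sub_dom hε.symm m hx hint,
    D.contMDiffOn_glue hε, D.symm.contMDiffOn_glue hε.symm, D.mapsTo_glue hε, D.symm.mapsTo_glue hε.symm,
    fun x hx => D.glue_symm_glue hε hx, fun x hx => D.symm.glue_symm_glue hε.symm hx,
    fun m x hx hxm => D.glue_mem_sector hε hx hxm, fun m x hx hxm => D.symm.glue_mem_sector hε.symm hx hxm,
    fun m x hx hxm => D.glue_level hε hx hxm⟩

end Summit.SmoothPoincare4.SmoothPoincare4.Cruxes.AgkCor6Sufficiency.LpBySphereSystemSurgery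

end
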